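import Summits.AtomisticToContinuum.HydrodynamicLimit.Theorems.BoxDissipativeWeakStrongRelativeEnergyStabilityDefs
import Summits.AtomisticToContinuum.HydrodynamicLimit.Theorems.BoxDissipativeWeakStrongEntropyAdmissibilityStubDynPartIntegrable
import Summits.AtomisticToContinuum.HydrodynamicLimit.Theorems.BoxDissipativeWeakStrongEntropyAdmissibilityMeanEntropyDeficitNecessary
import Summits.AtomisticToContinuum.HydrodynamicLimit.Theorems.BoxDissipativeWeakStrongFluxClosureDefectAEMeasurable
import HarnessLib

/-!
# Crux `RelativeEnergyStability` (stmt-AtomisticToContinuum-17653), line `registered`, heart stub S-X —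
# a.e.-measurability of the K1 / K2 functionals (`sx_aemeasurable_K1`, `sx_aemeasurable_K2`)

Registered sub-goals of the heart stub S-X (expectation layer of the Březina–Feireisl bookkeeping). The pathwise
Grönwall inequality of the clamped box relative energy (`sx_pathwise`) carries the two route defects
`|K1_t(z)|` (box momentum balance of `FluxClosure` tested with `w := u`) and `max (K2_t(z)) 0` (clamp-renormalised
entropy balance of `EntropyAdmissibility` tested with `φ := θ`), written over `RES.boxState`. To integrate them
against the local Gibbs law `P_N = localGibbsLaw σ a₀ u₀ θ₀ N (Φ N)` the functionals `z ↦ K1_t(z)`, `z ↦ K2_t(z)`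
must be `P_N`-a.e.-measurable. Both facts are already in the tree up to definitional unfolding:

* K1: `FluxClosureFmt.W2d.defect_aemeasurable` (the route's `let`-bound `K, Dn, Mm, En, Th, Zc, Pc` have the same
  bodies as `RES.boxKernel`, the components of `RES.boxState`, and `RES.cutCompressibility`), composed with `|·|`;
* K2: the functional is `BDWS.dynPart … + BDWS.initPart …` on the nose (`BDWS.boxKernel`, `BDWS.cutExcessFreeEnergy`,
  `BDWS.cutEntropy`, `BDWS.boxTemp`, `clamp` versus `RES.boxKernel`, `(RES.cutEOS σ η₁).s`, `max a (min · b)` —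
  same bodies), and both parts are integrable under `P_N` (`EABirthS1a.integrable_dynPart`,
  `EABirthS1bNec.integrable_initPart`, `P_N` being a probability measure for `σ ≤ 1/2`).

References: J. Březina, E. Feireisl, J. Math. Soc. Japan 70 (2018), §3.2; H. Spohn, *Large Scale Dynamics of
Interacting Particles* (1991), Part I Ch. 3.
-/

noncomputable section

namespace Summit.AtomisticToContinuum.HydrodynamicLimit.Theorems.RES

open MeasureTheory Filter Set Function
open scoped Topology InnerProductSpace ENNReal
open Summit.AtomisticToContinuum.HydrodynamicLimit.Theses.BoxDissipativeWeakStrong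
open Literature.MathematicalPhysics.KineticTheory Literature.Analysis.FluidPDE Literature.Analysis.FunctionSpaces
open Literature.Analysis.FluidPDE.CompressibleEuler
open Literature.Analysis.FluidPDE.CompressibleEuler.EulerPhase
open Literature.Analysis.FluidPDE.CompressibleEuler.StrongPointData

/-- (D2) a.e.-measurability under the local Gibbs law of the pathwise K2 functional (clamp-renormalised entropy balance
tested with `φ := θ`) at time `t`. -/
theorem sx_aemeasurable_K2 {η₀ : ℝ} (hcont : ContinuousOn hsExcessFreeEnergy (Ico 0 η₀)) {σ η₁ T : ℝ}
    (hσ : 0 < σ) (hσ2 : σ ≤ 1 / 2) (hη₁ : 0 < η₁) (hη₁₀ : η₁ < η₀) {θ : ℝ → T3 → ℝ}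
    (hθs : Torus.IsSmoothSpaceTimeOn (Ico 0 T) θ) {a₀ θ₀ : T3 → ℝ} {u₀ : T3 → V3} (ha : Continuous a₀)
    (hθ : Continuous θ₀) (hu : Continuous u₀) (ha0 : ∀ x, 0 < a₀ x) (hθ0 : ∀ x, 0 < θ₀ x)
    (Φ : (N : ℕ) → HardSphereFlow (Literature.Analysis.FluidPDE.Torus.geometry (Fin 3)) (hsDiameter σ N) (N + 1))
    (ℓ : ℕ → ℝ) (hℓ : ∀ N, 0 < ℓ N ∧ ℓ N ≤ 1) (N : ℕ) {a b : ℝ} (hab : a ≤ b) {t : ℝ} (ht : t ∈ Ico 0 T) :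
    AEMeasurable (fun z : Config (N + 1) (Fin 3) T3 => ((∫ s in Ioc 0 t, ∫ x,
                        ((boxState (ℓ N) ((Φ N).flow s z) x).1 *
                              max a (min ((cutEOS σ η₁).s (boxState (ℓ N) ((Φ N).flow s z) x).1
                                (2 / 3 * ((boxState (ℓ N) ((Φ N).flow s z) x).2.2 /
                                    (boxState (ℓ N) ((Φ N).flow s z) x).1 -
                                  ‖(boxState (ℓ N) ((Φ N).flow s z) x).2.1‖ ^ 2 /
                                    (2 * (boxState (ℓ N) ((Φ N).flow s z) x).1 ^ 2)))) b) *
                            Torus.timeDerivWithin (Ico 0 T) θ s x +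
                          max a (min ((cutEOS σ η₁).s (boxState (ℓ N) ((Φ N).flow s z) x).1
                                (2 / 3 * ((boxState (ℓ N) ((Φ N).flow s z) x).2.2 /
                                    (boxState (ℓ N) ((Φ N).flow s z) x).1 -
                                  ‖(boxState (ℓ N) ((Φ N).flow s z) x).2.1‖ ^ 2 /
                                    (2 * (boxState (ℓ N) ((Φ N).flow s z) x).1 ^ 2)))) b) *
                            inner ℝ (boxState (ℓ N) ((Φ N).flow s z) x).2.1 (Torus.gradient (θ s) x))) -
                      (∫ x, (boxState (ℓ N) ((Φ N).flow t z) x).1 *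
                          max a (min ((cutEOS σ η₁).s (boxState (ℓ N) ((Φ N).flow t z) x).1
                            (2 / 3 * ((boxState (ℓ N) ((Φ N).flow t z) x).2.2 /
                                (boxState (ℓ N) ((Φ N).flow t z) x).1 -
                              ‖(boxState (ℓ N) ((Φ N).flow t z) x).2.1‖ ^ 2 /
                                (2 * (boxState (ℓ N) ((Φ N).flow t z) x).1 ^ 2)))) b) * θ t x) +
                      (∫ x, (boxState (ℓ N) ((Φ N).flow 0 z) x).1 *
                          max a (min ((cutEOS σ η₁).s (boxState (ℓ N) ((Φ N).flow 0 z) x).1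
                            (2 / 3 * ((boxState (ℓ N) ((Φ N).flow 0 z) x).2.2 /
                                (boxState (ℓ N) ((Φ N).flow 0 z) x).1 -
                              ‖(boxState (ℓ N) ((Φ N).flow 0 z) x).2.1‖ ^ 2 /
                                (2 * (boxState (ℓ N) ((Φ N).flow 0 z) x).1 ^ 2)))) b) * θ 0 x)))
      (localGibbsLaw σ a₀ u₀ θ₀ N (Φ N)) := by
  haveI : IsProbabilityMeasure (localGibbsLaw σ a₀ u₀ θ₀ N (Φ N)) :=
    isProbabilityMeasure_localGibbsLaw ha hθ hu ha0 hθ0 hσ2 N (Φ N)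
  have hT : 0 < T := ht.1.trans_lt ht.2
  have h1 : Integrable (BDWS.dynPart σ η₁ T ℓ Φ t a b θ N) (localGibbsLaw σ a₀ u₀ θ₀ N (Φ N)) :=
    EABirthS1a.integrable_dynPart hcont hη₁ hη₁₀ ha hθ hu ha0 hθ0 hσ hσ2 Φ (hℓ N).1 ht hab hθs
  have h2 : Integrable (BDWS.initPart σ η₁ ℓ Φ a b θ N) (localGibbsLaw σ a₀ u₀ θ₀ N (Φ N)) :=
    EABirthS1bNec.integrable_initPart hcont hσ.le hη₁.le hη₁₀ Φ (hℓ N).1 hT hab hθs _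
  exact (h1.add h2).aestronglyMeasurable.aemeasurable

/-- (D3) a.e.-measurability under the local Gibbs law of the pathwise K1 functional (box momentum-balance defect
tested with `w := u`) at time `t`. -/
theorem sx_aemeasurable_K1 {σ η₁ T : ℝ} {u : ℝ → T3 → V3} (hus : Torus.IsSmoothSpaceTimeOn (Ico 0 T) u)
    (a₀ θ₀ : T3 → ℝ) (u₀ : T3 → V3)
    (Φ : (N : ℕ) → HardSphereFlow (Literature.Analysis.FluidPDE.Torus.geometry (Fin 3)) (hsDiameter σ N) (N + 1))
    (ℓ : ℕ → ℝ) (hℓ : ∀ N, 0 < ℓ N ∧ ℓ N ≤ 1) (N : ℕ) {t : ℝ} (ht : t ∈ Ico 0 T) :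
    AEMeasurable (fun z : Config (N + 1) (Fin 3) T3 => (|(∫ x, inner ℝ (boxState (ℓ N) ((Φ N).flow t z) x).2.1 (u t x)) -
                      (∫ x, inner ℝ (boxState (ℓ N) ((Φ N).flow 0 z) x).2.1 (u 0 x)) -
                      ∫ s in Ioc 0 t, ∫ x,
                        (inner ℝ (boxState (ℓ N) ((Φ N).flow s z) x).2.1
                            (Torus.timeDerivWithin (Ico 0 T) u s x) +
                          (∑ i, ∑ j, (boxState (ℓ N) ((Φ N).flow s z) x).2.1 i *
                              (boxState (ℓ N) ((Φ N).flow s z) x).2.1 j /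
                              (boxState (ℓ N) ((Φ N).flow s z) x).1 *
                            Torus.partialDeriv j (fun y => u s y i) x) +
                          (boxState (ℓ N) ((Φ N).flow s z) x).1 *
                              (2 / 3 * ((boxState (ℓ N) ((Φ N).flow s z) x).2.2 /
                                  (boxState (ℓ N) ((Φ N).flow s z) x).1 -
                                ‖(boxState (ℓ N) ((Φ N).flow s z) x).2.1‖ ^ 2 /
                                  (2 * (boxState (ℓ N) ((Φ N).flow s z) x).1 ^ 2))) *
                              cutCompressibility η₁ ((boxState (ℓ N) ((Φ N).flow s z) x).1 * σ ^ 3) *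
                            Torus.divergence (u s) x)|))
      (localGibbsLaw σ a₀ u₀ θ₀ N (Φ N)) := by
  have h := FluxClosureFmt.W2d.defect_aemeasurable σ η₁ T a₀ θ₀ u₀ Φ ℓ hℓ t ht u hus N
  exact continuous_abs.measurable.comp_aemeasurable h

end Summit.AtomisticToContinuum.HydrodynamicLimit.Theorems.RES

end
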